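import Summits.ABC.ABC.Theses.TwistAmplification
import Literature.NumberTheory.CubicFields.ShintaniZeta

/-!
# Crux `TwistAmplification.SharpModerateLaw` (stmt-ABC-1975): objects of the line
`syzygy-lattice-half-deep-few-primes`

Definitions (no proofs of stubs) used by the positive-side files of this crux, i.e. by the registered
stubs of the checked skeleton `Cruxes/SharpModerateLaw/Lines/syzygy-lattice-half-deep-few-primes.lean`
(lead `prover-line-stmt-ABC-1975-0`) and by its composition theorem `SharpModerateLaw_of`:

* §A index-form coordinates on the tree's integral binary cubic forms `BinaryCubic ℤ`: the Hessian and
  cubic covariants `hessAt`, `covAt` (Cayley's syzygy `covAt² + 27·disc·F² = 4·hessAt³`, proved: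
  `syzygy`), the level `Mplus = max(|D·F²|, 256|H|³)` (`= 2⁸3⁶·max(|Δ|,|c₄|³)` on curve data), the
  conductor proxy away from `6` (`N5`, charging `p²` exactly at the primes of `H`, i.e. of `c₄`), the
  tower-freeness of the content (`ContentOK`), Kane's repeated radical `depthRad`, the dyadic index-form
  shell `ifShell`, the few-deep predicate `FewDeep`, the counts `shellCount`/`orbitTotal`/`totalCount`
  over maximal `GL₂(ℤ)`-orbit representatives (`orbitsOfDisc`, `orbitRep` of the tree), and the dyadic
  two-parameter laws `LawWith`, `IndexFormShellLaw`, `FewDeepLaw`, `SpreadLaw`;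
* §B cusp coordinates `(c₄, c₆)`: `TF`, `Mcusp`, `N5cusp`, `cuspShell`, `CuspShellLaw` (the triage's
  repaired transfer target C⁺′: dyadic in the level, conductor proxy with `p²` at additive primes,
  `c₄c₆ ≠ 0`, tower-free);
* §C the lattice half `LatticeHalf` (Kane, arXiv:1104.2635, Lemma 4 / Prop. 5 / Prop. 6, on a dyadic
  `Mplus`-shell uniformly in a maximal form), `hmax`, and the field sum `FieldSum`;
* §D the three implication-shaped stub statements `CuspTransfer`, `SyzygyTransfer`, `FewDeepOfLattice`.

These are the registered stub signatures of stmt-ABC-1975 (`ledger skeleton check`, 2026-08-16); the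
stubs themselves and the composition live in the skeleton / the stub files, not here. Statements are
verbatim those of the planner's checked skeleton (planner-cruxplan-stmt-ABC-1975-syzygy-lattice-half--0).
-/


noncomputable section

namespace Summit.ABC.ABC.Theorems.SharpModerateLaw

open Literature.NumberTheory.CubicFields
open UniqueFactorizationMonoid (radical)
open scoped BigOperators

/-! ## A. Index-form coordinates (binary cubic forms of the tree, `BinaryCubic ℤ`) -/

/-- Value of the Hessian covariant `H_F = (b²−3ac, bc−9ad, c²−3bd)` at `(u,v)` (`= 9·c₄`). -/
def hessAt (F : BinaryCubic ℤ) (u v : ℤ) : ℤ :=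
  (F.b ^ 2 - 3 * F.a * F.c) * u ^ 2 + (F.b * F.c - 9 * F.a * F.d) * u * v
    + (F.c ^ 2 - 3 * F.b * F.d) * v ^ 2

/-- Value of the cubic covariant `G_F` at `(u,v)` (`G(1,0) = 2b³ − 9abc + 27a²d`; `= −54·c₆`). -/
def covAt (F : BinaryCubic ℤ) (u v : ℤ) : ℤ :=
  (2 * F.b ^ 3 - 9 * F.a * F.b * F.c + 27 * F.a ^ 2 * F.d) * u ^ 3
    + (3 * F.b ^ 2 * F.c - 18 * F.a * F.c ^ 2 + 27 * F.a * F.b * F.d) * u ^ 2 * v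
    + (-3 * F.b * F.c ^ 2 + 18 * F.b ^ 2 * F.d - 27 * F.a * F.c * F.d) * u * v ^ 2
    + (-2 * F.c ^ 3 + 9 * F.b * F.c * F.d - 27 * F.a * F.d ^ 2) * v ^ 3

/-- **Cayley's syzygy** `G² + 27·D·F² = 4·H³` (kernel-checked; the dictionary of the whole line). -/
theorem syzygy (F : BinaryCubic ℤ) (u v : ℤ) :
    covAt F u v ^ 2 + 27 * F.disc * F.eval u v ^ 2 = 4 * hessAt F u v ^ 3 := by
  simp only [covAt, hessAt, BinaryCubic.disc_eq, BinaryCubic.eval]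
  ring

/-- Cayley's syzygy, closed form (registered sub-goal `syzygy_holds` of stmt-ABC-1975: the dictionary identity
every stub of the line uses). -/
theorem syzygy_holds : ∀ (F : BinaryCubic ℤ) (u v : ℤ),
    covAt F u v ^ 2 + 27 * F.disc * F.eval u v ^ 2 = 4 * hessAt F u v ^ 3 :=
  fun F u v => syzygy F u v

/-- The `(1,0)`-normal form of the 2-division cubic of a curve with invariants `(c₄, c₆)`:
`F₀ = (1, 0, −3c₄, −2c₆)` has `H(1,0) = 9c₄`, `G(1,0) = −54c₆`, `D = 108(c₄³ − c₆²)`, so that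
`D·F₀(1,0)² = 108·1728·Δ = 2⁸3⁶Δ` (the normalisation behind `SyzygyTransfer`). -/
theorem normalForm_invariants (c₄ c₆ : ℤ) :
    hessAt ⟨1, 0, -3 * c₄, -2 * c₆⟩ 1 0 = 9 * c₄ ∧ covAt ⟨1, 0, -3 * c₄, -2 * c₆⟩ 1 0 = -54 * c₆ ∧
      (⟨1, 0, -3 * c₄, -2 * c₆⟩ : BinaryCubic ℤ).disc = 108 * (c₄ ^ 3 - c₆ ^ 2) := by
  refine ⟨?_, ?_, ?_⟩
  · simp only [hessAt]; ring
  · simp only [covAt]; ring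
  · simp only [BinaryCubic.disc_eq]; ring

/-- `Mplus F q = max(|D·F(q)²|, 256·|H_F(q)|³) = 2⁸3⁶ · max(|Δ|, |c₄|³) = 2⁸3⁶·M⁺` of the corresponding curve. -/
def Mplus (F : BinaryCubic ℤ) (q : ℤ × ℤ) : ℕ :=
  max (F.disc * F.eval q.1 q.2 ^ 2).natAbs (256 * (hessAt F q.1 q.2).natAbs ^ 3)

/-- Conductor proxy away from `6` in index-form coordinates: `∏_{p ≥ 5, p ∣ D·F(q)} (p² if p ∣ H_F(q) else p)`
(for `p ≥ 5`: `p ∣ Δ ⟺ p ∣ D·F(q)`, `p ∣ c₄ ⟺ p ∣ H_F(q)`; on minimal models this is `N/(2^{f₂}3^{f₃})`). -/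
def N5 (F : BinaryCubic ℤ) (q : ℤ × ℤ) : ℕ :=
  ∏ p ∈ (F.disc * F.eval q.1 q.2).natAbs.primeFactors with 5 ≤ p,
    if ((p : ℕ) : ℤ) ∣ hessAt F q.1 q.2 then p ^ 2 else p

/-- Tower-freeness in index-form coordinates (a consequence of `TF`, i.e. of minimality): the content
`g = gcd(u,v)` (= the twist parameter) has `p² ∤ g` for `p ≥ 5`, `2⁴ ∤ g`, `3⁴ ∤ g`. -/
def ContentOK (q : ℤ × ℤ) : Prop :=
  (∀ p : ℕ, p.Prime → 5 ≤ p → ¬ p ^ 2 ∣ Int.gcd q.1 q.2) ∧ ¬ 2 ^ 4 ∣ Int.gcd q.1 q.2 ∧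
    ¬ 3 ^ 4 ∣ Int.gcd q.1 q.2

/-- Kane's repeated radical `v(n) = ∏_{p² ∣ n} p = rad(n / rad n)` (the "depth carrier" of `n`). -/
def depthRad (n : ℕ) : ℕ :=
  radical (n / radical n)

/-- The index-form shell at conductor budget `X` and dyadic level `Y` for the form `F`:
`(u,v)` with `F, H, G ≠ 0` there (Δ, c₄, c₆ ≠ 0), tower-free content, `Y ≤ Mplus < 2Y`, `N5 ≤ X`. -/
def ifShell (F : BinaryCubic ℤ) (X Y : ℝ) : Set (ℤ × ℤ) :=
  {q | F.eval q.1 q.2 ≠ 0 ∧ hessAt F q.1 q.2 ≠ 0 ∧ covAt F q.1 q.2 ≠ 0 ∧ ContentOK q ∧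
    Y ≤ (Mplus F q : ℝ) ∧ (Mplus F q : ℝ) < 2 * Y ∧ (N5 F q : ℝ) ≤ X}

/-- The FEW-DEEP-PRIMES predicate at `(X, Y)`: with `g = gcd(u,v)` and `(u₀,v₀) = (u,v)/g`, the depth
carrier `g · rad(D) · v(F(u₀,v₀))` is at most the dyadic law `X·Y^{-1/6}` (Kane's `w`-cap, made intrinsic). -/
def FewDeep (X Y : ℝ) (F : BinaryCubic ℤ) (q : ℤ × ℤ) : Prop :=
  ((Int.gcd q.1 q.2 : ℕ) : ℝ) * ((radical F.disc.natAbs : ℕ) : ℝ) *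
      ((depthRad (F.eval (q.1 / (Int.gcd q.1 q.2 : ℤ)) (q.2 / (Int.gcd q.1 q.2 : ℤ))).natAbs : ℕ) : ℝ)
    ≤ X * Y ^ (-(1 / 6 : ℝ))

/-- Count of the `P`-part of the shell of a form; zero unless the form is MAXIMAL (tree notion
`RingOfForm.IsMaximal` = maximal cubic ring, i.e. the index form of a maximal order). -/
def shellCount (P : ℝ → ℝ → BinaryCubic ℤ → ℤ × ℤ → Prop) (X Y : ℝ)
    (F : BinaryCubic ℤ) : ℕ :=
  Set.ncard {q : ℤ × ℤ | RingOfForm.IsMaximal F ∧ q ∈ ifShell F X Y ∧ P X Y F q}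

/-- Sum of a weight over the `GL₂(ℤ)`-orbits of discriminant `D`, evaluated at the tree's orbit
representative `orbitRep` (a finite sum for `D ≠ 0`, `finite_orbitsOfDisc`). -/
def orbitTotal (D : ℤ) (w : BinaryCubic ℤ → ℕ) : ℕ :=
  ∑ᶠ O : orbitsOfDisc D, w (orbitRep O)

/-- Total index-form count at `(X, Y)`: over all discriminants `0 < |D| ≤ ⌈2Y⌉` (note `|D| ≤ Mplus < 2Y`)
and all maximal orbits of that discriminant, of the `P`-part of the shell of the representative. -/
def totalCount (P : ℝ → ℝ → BinaryCubic ℤ → ℤ × ℤ → Prop) (X Y : ℝ) : ℕ :=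
  ∑ D ∈ (Finset.Icc (-(⌈2 * Y⌉₊ : ℤ)) (⌈2 * Y⌉₊ : ℤ)).erase 0, orbitTotal D (shellCount P X Y)

/-- Two-parameter dyadic law for the `P`-part with additive constant `c`:
`totalCount P X Y ≤ C_ε (XY)^ε (X·Y^{-1/6} + c)` for all `X, Y ≥ 1`. -/
def LawWith (P : ℝ → ℝ → BinaryCubic ℤ → ℤ × ℤ → Prop) (c : ℝ) : Prop :=
  ∀ ε : ℝ, 0 < ε → ∃ C : ℝ, ∀ X Y : ℝ, 1 ≤ X → 1 ≤ Y →
    (totalCount P X Y : ℝ) ≤ C * (X * Y) ^ ε * (X * Y ^ (-(1 / 6 : ℝ)) + c)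

/-- **C⁺ (index-form shell law).** The whole shell: `≤ C_ε (XY)^ε (X·Y^{-1/6} + 1)`. -/
def IndexFormShellLaw : Prop := LawWith (fun _ _ _ _ => True) 1

/-- **Few-deep-primes law** (NO additive term: the few-deep set is empty once `X·Y^{-1/6} < 1`). -/
def FewDeepLaw : Prop := LawWith FewDeep 0

/-- **Spread law** (the open core; carries the `+1`). -/
def SpreadLaw : Prop := LawWith (fun X Y F q => ¬ FewDeep X Y F q) 1

/-! ## B. Cusp coordinates `(c₄, c₆)` -/

/-- Tower-freeness of `(c₄, c₆)`: the divisibility patterns that a model minimal at every prime cannot have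
(`p ≥ 5`: `p⁴ ∣ c₄ ∧ p⁶ ∣ c₆`; `2⁸ ∣ c₄ ∧ 2¹¹ ∣ c₆`; `3⁵ ∣ c₄ ∧ 3⁹ ∣ c₆`; tree:
`WeierstrassCurve.not_pow_dvd_c₄_c₆_of_isMinimalAt{,_two,_three}`). -/
def TF (x : ℤ × ℤ) : Prop :=
  (∀ p : ℕ, p.Prime → 5 ≤ p → ¬ ((p : ℤ) ^ 4 ∣ x.1 ∧ (p : ℤ) ^ 6 ∣ x.2)) ∧
  ¬ ((2 : ℤ) ^ 8 ∣ x.1 ∧ (2 : ℤ) ^ 11 ∣ x.2) ∧ ¬ ((3 : ℤ) ^ 5 ∣ x.1 ∧ (3 : ℤ) ^ 9 ∣ x.2)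

/-- `M⁺(c₄, c₆) = max(|Δ|, |c₄|³)` with `Δ = (c₄³ − c₆²)/1728` (exact on the set where `1728 ∣ c₄³ − c₆²`). -/
def Mcusp (x : ℤ × ℤ) : ℕ :=
  max ((x.1 ^ 3 - x.2 ^ 2) / 1728).natAbs (x.1.natAbs ^ 3)

/-- Conductor proxy away from `6`: `∏_{p ≥ 5, p ∣ Δ} (p² if p ∣ c₄ else p)`; it divides the conductor of
every minimal model with these invariants (multiplicative `f_p = 1`, additive `f_p = 2` for `p ≥ 5`). -/
def N5cusp (x : ℤ × ℤ) : ℕ :=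
  ∏ p ∈ ((x.1 ^ 3 - x.2 ^ 2) / 1728).natAbs.primeFactors with 5 ≤ p,
    if ((p : ℕ) : ℤ) ∣ x.1 then p ^ 2 else p

/-- The cusp shell: `(c₄, c₆)` with `c₄c₆ ≠ 0`, `Δ ≠ 0`, `1728 ∣ c₄³ − c₆²`, tower-free,
`Y ≤ M⁺ < 2Y`, `N5cusp ≤ X` (dyadic in the level — the cumulative version is false, triage `not_CuspCountLaw`). -/
def cuspShell (X Y : ℝ) : Set (ℤ × ℤ) :=
  {x | x.1 ≠ 0 ∧ x.2 ≠ 0 ∧ x.1 ^ 3 ≠ x.2 ^ 2 ∧ (1728 : ℤ) ∣ x.1 ^ 3 - x.2 ^ 2 ∧ TF x ∧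
    Y ≤ (Mcusp x : ℝ) ∧ (Mcusp x : ℝ) < 2 * Y ∧ (N5cusp x : ℝ) ≤ X}

/-- **Cusp shell law** `#cuspShell(X,Y) ≤ C_ε (XY)^ε (X·Y^{-1/6} + 1)` — the triage's repaired common
transfer target C⁺′ (conductor proxy, dyadic level, `c₄c₆ ≠ 0`, TF). -/
def CuspShellLaw : Prop :=
  ∀ ε : ℝ, 0 < ε → ∃ C : ℝ, ∀ X Y : ℝ, 1 ≤ X → 1 ≤ Y →
    (Set.ncard (cuspShell X Y) : ℝ) ≤ C * (X * Y) ^ ε * (X * Y ^ (-(1 / 6 : ℝ)) + 1)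

/-! ## C. The lattice half and the field sum -/

/-- **Kane's lattice half on a dyadic `Mplus`-shell, uniformly in the MAXIMAL form.** For `F` maximal
with `D ≠ 0`, a forced divisor `t ≥ 1`, level `Y`, radical budget `B` and depth cap `w`: the primitive
`(u,v)` with `Y ≤ Mplus < 2Y`, `F(u,v) ≠ 0`, `t ∣ D·F(u,v)`, `rad(D·F(u,v)) ≤ B`, `v(F(u,v)) ≤ w` number
`≤ C_ε (|D|·Y·B·t)^ε · (B·Y^{-1/6}/rad(D·t) + w)` (Kane arXiv:1104.2635 Lemma 4, Prop. 5, Prop. 6,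
transported from `A + B + C = 0` to the index form of a maximal cubic ring). -/
def LatticeHalf : Prop :=
  ∀ ε : ℝ, 0 < ε → ∃ C : ℝ, ∀ F : BinaryCubic ℤ, RingOfForm.IsMaximal F → F.disc ≠ 0 →
    ∀ t : ℕ, 1 ≤ t → ∀ Y B w : ℝ, 1 ≤ Y → 1 ≤ B → 1 ≤ w →
      (Set.ncard {q : ℤ × ℤ | Int.gcd q.1 q.2 = 1 ∧ Y ≤ (Mplus F q : ℝ) ∧ (Mplus F q : ℝ) < 2 * Y ∧
          F.eval q.1 q.2 ≠ 0 ∧ (t : ℤ) ∣ F.disc * F.eval q.1 q.2 ∧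
          ((radical (F.disc * F.eval q.1 q.2).natAbs : ℕ) : ℝ) ≤ B ∧
          ((depthRad (F.eval q.1 q.2).natAbs : ℕ) : ℝ) ≤ w} : ℝ)
        ≤ C * ((F.disc.natAbs : ℝ) * Y * B * t) ^ ε *
            (B * Y ^ (-(1 / 6 : ℝ)) / ((radical (F.disc * t).natAbs : ℕ) : ℝ) + w)

/-- `h_max(D)`: the number of `GL₂(ℤ)`-orbits of MAXIMAL forms of discriminant `D` (= maximal orders of
cubic étale algebras of discriminant `D`: cubic fields, `ℚ × quadratic`, `ℚ³`). -/
def hmax (D : ℤ) : ℕ :=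
  Nat.card {O : orbitsOfDisc D // RingOfForm.IsMaximal (orbitRep O)}

/-- **Field sum**: `Σ_{0 < |D| ≤ N} h_max(D)/rad(D) ≤ C_ε N^ε` (via Hasse's count of cubic fields of
discriminant `d₀f²` and Davenport's / Davenport–Heilbronn's `O(A)` bound for `Σ_{|d₀| ≤ A} h₃(d₀)`). -/
def FieldSum : Prop :=
  ∀ ε : ℝ, 0 < ε → ∃ C : ℝ, ∀ N : ℕ, 1 ≤ N →
    (∑ D ∈ (Finset.Icc (-(N : ℤ)) N).erase 0, (hmax D : ℝ) / ((radical D.natAbs : ℕ) : ℝ))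
      ≤ C * (N : ℝ) ^ ε

/-! ## D. The implication-shaped stub statements -/

/-- Statement of `stub_cuspTransfer`: the cusp shell law implies the crux. -/
def CuspTransfer : Prop :=
  CuspShellLaw → Summit.ABC.ABC.Theses.TwistAmplification.SharpModerateLaw

/-- Statement of `stub_syzygyTransfer`: the index-form shell law implies the cusp shell law. -/
def SyzygyTransfer : Prop :=
  IndexFormShellLaw → CuspShellLaw

/-- Statement of `stub_fewDeepOfLattice`: lattice half + field sum give the few-deep-primes law. -/
def FewDeepOfLattice : Prop :=
  LatticeHalf → FieldSum → FewDeepLaw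

end Summit.ABC.ABC.Theorems.SharpModerateLaw

end
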